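import Literature.NumberTheory.Transcendental.RoySmallValueEstimatesProp14Proofs
import HarnessLib

/-!
# Route `RoyCriterion`, crux `NguyenRoySmallValueTranslates` (stmt-Schanuel-1051), line `Sketch`
# — stub `stub_noTranslateInConj`

Registered stub F of the skeleton of line `Sketch` for the crux
`Summit.Schanuel.Schanuel.Theses.RoyCriterion.NguyenRoySmallValueTranslates`: the concrete
"aperiodicity of classes" input of the sharpened §6 of Nguyen–Roy 2016 for the model
`NguyenRoy.endgame` (`V = AlgPt`, `pts = AlgPt.conj`, `τ = tauQ r hs0`). For `r ≠ 0`,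
`s ≠ 0, ±1`, an algebraic point `Z` with `#conj Z ≥ 2`, `a ∈ conj Z` and `k ≠ 0`:
`τᵏ a ∉ conj Z`.

Proof. If `τᵏ a ∈ conj Z`, then (classes of conjugates being equal or disjoint) the class of
`τᵏ a`, which is `τᵏ(conj a) = τᵏ(conj Z)` (`AlgPt.conj_tauA`), equals `conj Z`; a finite
`τᵏ`-invariant set consists of the two fixed points `(0:1:0)`, `(0:0:1)` of the powers of `τ`
(`subset_of_image_tauP_eq`), so `a` is one of them; but a point with rational homogeneous
coordinates has field of definition `ℚ`, hence a one-point class (`#conj = [ℚ(a):ℚ] = 1`),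
contradicting `#conj Z ≥ 2`.

## References

* [NguyenRoy2016] N. A. V. Nguyen, D. Roy, IJNT 12 (2016) 1273–1293 = arXiv:1412.5163, §4
  (zero-dimensional subvarieties and their translates), §5, proof of Proposition 14 (the fixed
  points of `τᵏ`).
-/

-- `Summit.Schanuel.Schanuel.…` is the mandated layout of this single-problem summit (CONVENTIONS §1).
set_option linter.dupNamespace false

noncomputable section

open Filter Finset
open scoped Classical

namespace Summit.Schanuel.Schanuel.Theorems.NguyenRoySharp

open Literature.NumberTheory.Transcendental
open Literature.NumberTheory.Transcendental.NguyenRoy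

/-- **A point with rational homogeneous coordinates has a one-point class of conjugates**: if
`P = [v]` with all `v j ∈ ℚ ⊆ ℂ`, then `ℚ(P) = ℚ` (the normalised coordinates `v j / v_{pivot}`
are rational), so `#conj P = [ℚ(P):ℚ] = 1`. [cite: NguyenRoy2016, §4 (deg Z = [ℚ(α):ℚ])] -/
theorem card_conj_eq_one_of_mem_bot (P : AlgPt) {v : V3} (hv : v ≠ 0)
    (hP : P.1 = Projectivization.mk ℂ v hv) (hrat : ∀ j, v j ∈ (⊥ : IntermediateField ℚ ℂ)) :
    P.conj.card = 1 := by
  rw [P.card_conj, AlgPt.deg, IntermediateField.finrank_eq_one_iff, ← le_bot_iff, Kp,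
    IntermediateField.adjoin_le_iff]
  rintro _ ⟨j, rfl⟩
  rw [hP, (nv_mk hv).1]
  exact div_mem (hrat j) (hrat _)

/-- **Stub F — no point of a conjugacy class with at least two points has a non-zero rational
translate in the class.** For `r ≠ 0`, `s ≠ 0, ±1`, `Z : AlgPt` with `#conj Z ≥ 2`, `a ∈ conj Z`
and `k ≠ 0`: `τ^k a ∉ conj Z`. Otherwise `conj (τᵏ a) = τᵏ(conj Z)` meets `conj Z`, so they are
equal (`AlgPt.conj_eq_of_mem_conj`), `conj Z` is a finite `τᵏ`-invariant set, hence contained in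
the fixed points `{(0:1:0), (0:0:1)}` (`subset_of_image_tauP_eq`), whose classes are singletons —
contradicting `#conj Z ≥ 2`. [cite: NguyenRoy2016, §5, proof of Proposition 14] -/
theorem stub_noTranslateInConj {r s : ℚ} (hr : r ≠ 0) (hs0 : s ≠ 0) (hs1 : s ≠ 1) (hs2 : s ≠ -1)
    (Z : AlgPt) (h2 : 2 ≤ Z.conj.card) {a : PPt} (ha : a ∈ Z.conj) {k : ℤ} (hk : k ≠ 0) :
    tauQ r hs0 k a ∉ Z.conj := by
  intro hb
  -- the class of `a` is `conj Z`, the class of `τᵏ a` is `τᵏ (conj Z)` and also `conj Z`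
  set A : AlgPt := ⟨a, Z.isAlgPt_of_mem_conj ha⟩
  have hA : A.conj = Z.conj := Z.conj_eq_of_mem_conj (Q := A) ha
  have hT : (A.tauA r hs0 k).conj = Z.conj := Z.conj_eq_of_mem_conj (Q := A.tauA r hs0 k) hb
  rw [A.conj_tauA r hs0 k, hA] at hT
  -- `conj Z` is `τᵏ`-invariant, hence inside the fixed points
  have hT' : Z.conj.image (tauP (r : ℂ) (cast_ne_zero' hs0) k) = Z.conj := hT
  have hfix := subset_of_image_tauP_eq (Rat.cast_ne_zero.mpr hr) (cast_ne_zero' hs0)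
    (fun i hi => rat_cast_zpow_ne_one hs1 hs2 hi) hk hT' a ha
  -- but the class of a fixed point is a singleton
  have hcard : Z.conj.card = 1 := by
    rw [← hA]
    rcases hfix with h | h
    · exact card_conj_eq_one_of_mem_bot A e010_ne_zero h fun j => by
        fin_cases j <;> simp
    · exact card_conj_eq_one_of_mem_bot A e001_ne_zero h fun j => by
        fin_cases j <;> simp
  omega

end Summit.Schanuel.Schanuel.Theorems.NguyenRoySharp

end
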